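import Mathlib
import HarnessLib
import Literature.Topology.FourManifolds.SPC4Wave0
import Literature.AlgebraicTopology.SingularHomology.SingularChains
import Literature.AlgebraicTopology.SingularHomology.CompactManifoldFiniteness
import Literature.Geometry.Kaehler.ManifoldFormsPullback
import Literature.Geometry.Symplectic.ThomGysinComplementSurfaceFour
import Literature.Geometry.Symplectic.SymplecticOrientation
import Summits.SmoothPoincare4.SmoothPoincare4.Theorems.SymplecticOrigamiNoGenusTwoDoorStubTaubesCanonicalCurveDoorLattice

/-! # Stub `stub_closingUp` of line `canonical-cap-filling` for crux `NoGenusTwoDoor`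
(stmt-SmoothPoincare4-7842, route SymplecticOrigami) — the `b₂ = 1` half PROVED, the `b₁ = 2`
half CLOSED MODULO ONE NAMED FACT of the tree

**Statement (S5, closing up; the card's `GenusTwoPinsDoor`, generalised).** Let `(N, s)` be a
closed connected symplectic `4`-manifold (`s : MForm`, chartwise smooth, closed, pointwise
non-degenerate) and `B = b(S)` a smoothly embedded compact connected `s`-symplectic surface of
genus `2` (`rank H₁(S; ℤ) = 4`) with MERIDIAN INJECTIVITY (`H₁(N ∖ B; ℤ) → H₁(N; ℤ)` injective)
and FLAT complement (the image of `H₂(N ∖ B; ℤ) → H₂(N; ℤ)` is torsion).  Then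
`(rank H₁(N; ℤ), rank H₂(N; ℤ)) = (2, 1)`: `N` is a door.

**What is proved here.**
* `finrank_singularHomology_two_eq_one_of_injective_of_flat` and the registered sub-goal
  `stub_closingUp_b2` — the `b₂(N) = 1` HALF, UNCONDITIONALLY: for any closed `ℤ`-oriented `N`
  and closed connected `ℤ`-oriented surface `S` (the symplectic data only supply the two
  orientations, `Literature.Geometry.Symplectic.SymplecticOrientation`).  Upper bound: the exact
  sequence of the pair `H₂(N ∖ B) → H₂(N) → H₂(N, N ∖ B)` (the tree's
  `relativeSingularHomology.exact_map_ofAbsolute`) with `H₂(N, N ∖ B; ℤ) ≅ Ȟ²(B) ≅ H²(S) ≅ ℤ`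
  (Čech–Alexander–Poincaré duality along the compact `B`, tautness, Poincaré duality on `S` —
  all PROVED in the tree; the identification is ADAPTED from the tree's proof
  `Literature.Geometry.Symplectic.thomGysin_complement_surface_four_holds`): the kernel of
  `H₂(N) → ℤ` is the torsion image of `H₂(N ∖ B)`, so `rank H₂(N) ≤ 1` (rank–nullity over `ℤ`).
  Lower bound: by the PROVED Thom–Gysin fact `thomGysin_complement_surface_four` meridian
  injectivity kills the connecting map `δ : ℤ → H₁(N ∖ B)`, so `a ↦ ⟨a ⌣ σ, [N]⟩` is ONTO `ℤ`
  (`σ` the Poincaré dual of `b_*[S]`), whence `b_*[S]` is not torsion and `rank H₂(N) ≥ 1`.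
* `stub_closingUp_of_canonicalClass` — the WHOLE registered signature, verbatim, from the named
  fact `Literature.Geometry.Symplectic.canonicalClass_sq_and_adjunction_of_symplectic_four`
  (IN THE TREE, McDuff–Salamon 2017 Rem. 4.1.10 / Ex. 4.4.5: the symplectic orientation `μ` and
  canonical class `K` of a closed symplectic `4`-manifold have `b⁺ ≥ 1`, `K² = 2χ + 3σ`, and
  every embedded `s`-symplectic surface satisfies the ADJUNCTION EQUALITY
  `rank H₁(S) − 2 = B·B + K·B`).  Proof of `b₁ = 2`: with `b₂ = 1` and `b⁺ ≥ 1` the lattice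
  `H²(N; ℤ)/T` is `⟨+1⟩` with coordinate `e`
  (`…DoorLattice.exists_linearEquiv_intersectionForm_of_door`),
  `σ(N) = 1` (`signature_eq_one_of_door`), `χ(N) = 3 − 2b₁` (`relEuler_eq_of_finrank_two_eq_one`);
  writing `σ ≡ m`, `K ≡ k`: ontoness of `·σ` gives `m² = 1`, adjunction `4 − 2 = m² + km` gives
  `km = 1`, so `k² = 1 = 2(3 − 2b₁) + 3`, i.e. `b₁ = 2`.
Compactness of `N` is used throughout (Poincaré duality, finite generation; cf. the
non-compact door `T*T²` of `Theorems/NoGenusTwoDoor/Negative/NoncompactDoor`).  Tightness of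
flatness: `(Σ₂ ×~ S², S₊)` has `(b₁, b₂) = (4, 2)`.

Sources: Bredon, *Topology and Geometry* (1993) VI.11; Hatcher, *Algebraic Topology* (2002)
Thm. 2.16, §3.3 Thm. 3.30, Prop. 3.46; Miller, *Lectures on Algebraic Topology* (2020) Thm. 37.1;
Spanier (1966) Thm. 6.1.10; Milnor–Husemoller (1973) §I.2; McDuff–Salamon (2017) Rem. 4.1.10,
Ex. 4.4.5, (13.3.17); Gompf–Stipsicz (1999) §1.2, §1.4.
-/

noncomputable section
-- the prescribed namespace `Summit.<P>.<Sub>.…` duplicates `SmoothPoincare4` (P = Sub)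
set_option linter.dupNamespace false
open scoped Manifold ContDiff Topology ContinuousMap
open Set Function TopologicalSpace
open Literature.Geometry.Kaehler (MForm IsSmoothForm IsClosedForm mextDeriv)
open Literature.AlgebraicTopology.SingularHomology
open Literature.Topology.FourManifolds (singularHomologyZ)

namespace Summit.SmoothPoincare4.SmoothPoincare4.Theorems.NoGenusTwoDoor.CanonicalCapFilling

universe u

/-! ### The pair sequence of `(N, N ∖ B)` in degree two -/

section PairSequence

-- as in `ThomGysinComplementSurfaceFour`: concrete chains are `Finsupp`s and Čech cochain
-- complexes are `(ComplexShape.down ℕ).symm`-complexes up to unfolding of semireducible defs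
set_option backward.isDefEq.respectTransparency false

open CategoryTheory Literature.AlgebraicTopology.Homotopy Literature.Geometry.Symplectic

/-- **`H₂(N, N ∖ B; ℤ) ≅ ℤ` for a compact connected surface `B = b(S)` in a closed
`ℤ`-oriented `4`-manifold** (Bredon 1993, VI Thm. 11.3 with Def. 11.8: the Thom isomorphism
`H₂(N, N ∖ B) ≅ H₀(B) ≅ ℤ` of the normal disc bundle), obtained WITHOUT smoothness as
`H₂(N, N ∖ K) ≅ Ȟ²(K) ≅ H²(↥K) ≅ H²(S) ≅ ℤ`: Čech–Alexander–Poincaré duality along the compact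
`K = b(S)` (Miller 2020, Thm. 37.1 / Cor. 37.4 = Hatcher Prop. 3.46, the tree's
`HomologicalOrientation.cechDuality_res`), tautness of the locally contractible compact `K` in
the Euclidean neighbourhood retract `N` (Spanier Thm. 6.1.10, the tree's
`Cech.RetractionNhds.cechEquiv`) and evaluation on `[S]` (Poincaré duality on `S`, Hatcher
Thm. 3.30).  Adapted from the tree's proof of `thomGysin_complement_surface_four_holds`.
[cite: Bredon1993, Ch. VI Thm. 11.3 and Def. 11.8] [cite: Miller2020, Thm. 37.1, Cor. 37.4]
[cite: HatcherAT2002, §3.3 Prop. 3.46 and Thm. 3.30] -/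
theorem nonempty_linearEquiv_relativeSingularHomology_two_int
    {N : Type} [TopologicalSpace N] [T2Space N] [CompactSpace N]
    [ChartedSpace (EuclideanSpace ℝ (Fin 4)) N]
    (μ : HomologicalOrientation ℤ N 4)
    {S : Type} [TopologicalSpace S] [CompactSpace S] [ConnectedSpace S]
    [ChartedSpace (EuclideanSpace ℝ (Fin 2)) S]
    (μS : HomologicalOrientation ℤ S 2) {b : S → N} (hb : Topology.IsEmbedding b) :
    Nonempty (relativeSingularHomology ℤ ℤ N (Set.range b)ᶜ 2 ≃ₗ[ℤ] ℤ) := by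
  -- adapted from `Literature.Geometry.Symplectic.thomGysin_complement_surface_four_holds`
  classical
  haveI : T2Space S := hb.t2Space
  set K : Set N := Set.range b with hKdef
  have hKc : IsCompact K := isCompact_range hb.continuous
  have hK : IsClosed K := hKc.isClosed
  let e : S ≃ₜ ↥K := hb.toHomeomorph
  -- Čech duality along `K` for the restricted fundamental class `[N]|_K`
  set γK := clocalHomology.res ℤ ℤ N (Set.subset_univ K) 4
    ((relativeSingularHomology.concreteIso ℤ ℤ N (Set.univ : Set N)ᶜ 4).hom
      (relativeSingularHomology.ofAbsolute ℤ ℤ N (Set.univ : Set N)ᶜ 4 μ.fundamentalClass)) with hγK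
  have hD : CechDuality hK 4 γK := μ.cechDuality_res μ.res_fundamentalClass_point hK
  -- tautness of `K`: `Ȟ^p(K; ℤ) ≃ H^p(↥K; ℤ)`
  obtain ⟨m, ι, hιc⟩ :=
    Literature.Geometry.Manifold.exists_isClosedEmbedding_pi_of_compactSpace
      (EuclideanSpace ℝ (Fin 4)) (M := N)
  have hNR : IsNeighbourhoodRetract (Set.range ι) :=
    isNeighbourhoodRetract_range_of_compactSpace
      isNeighbourhoodRetract_of_locallyContractibleSpace_holds (EuclideanSpace ℝ (Fin 4))
      hιc.isEmbedding
  have hKl : LocallyContractibleSpace ↥K :=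
    locallyContractibleSpace_of_homeomorph e
      (locallyContractibleSpace_of_chartedSpace (EuclideanSpace ℝ (Fin 2)))
  obtain ⟨T⟩ := Cech.RetractionNhds.nonempty_of_locallyContractibleSpace (K := K)
    hιc.isEmbedding hNR hKc hKl
  -- the evaluation `H²(S; ℤ) ≃ ℤ`, `a ↦ ⟨a, [S]⟩`
  let EvS : singularCohomology ℤ ℤ S 2 ≃ₗ[ℤ] ℤ :=
    LinearEquiv.ofBijective ((kroneckerPairing ℤ ℤ S 2).flip μS.fundamentalClass)
      (bijective_kroneckerPairing_fundamentalClass_surface μS)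
  -- Čech duality in degree `(2, 2)`
  let C := LinearEquiv.ofBijective (cechCap hK two_add_two_eq_four γK) (hD 2 2 two_add_two_eq_four)
  exact ⟨(relativeSingularHomology.concreteIso ℤ ℤ N Kᶜ 2).toLinearEquiv ≪≫ₗ C.symm ≪≫ₗ
    (T.cechEquiv ℤ 2) ≪≫ₗ (singularCohomology.mapIso ℤ ℤ e 2).toLinearEquiv ≪≫ₗ EvS⟩

/-- **A `ℤ`-module with a linear functional whose kernel is torsion has rank `≤ 1`**
(rank–nullity over the domain `ℤ`, Bourbaki *Algèbre* II §7: `rank M = rank ker φ + rank im φ`,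
`rank ker φ = 0` for a torsion kernel, `rank im φ ≤ rank ℤ = 1`).  Stated for an arbitrary
`ℤ`-module structure; the torsion hypothesis is the additive-order one. [folklore] -/
theorem finrank_le_one_of_ker_torsion {M : Type} [AddCommGroup M] [Module ℤ M]
    (φ : M →ₗ[ℤ] ℤ) (hφ : ∀ x, φ x = 0 → IsOfFinAddOrder x) : Module.finrank ℤ M ≤ 1 := by
  -- the kernel has rank zero, for every `ℤ`-module structure on it
  have hk : ∀ inst : Module ℤ (LinearMap.ker φ), @Module.rank ℤ (LinearMap.ker φ) _ _ inst = 0 := by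
    intro inst
    rw [rank_eq_zero_iff]
    rintro ⟨x, hx⟩
    obtain ⟨n, hn, hnx⟩ := isOfFinAddOrder_iff_zsmul_eq_zero.1 (hφ x hx)
    exact ⟨n, hn, (int_smul_eq_zsmul inst n _).trans (Subtype.ext hnx)⟩
  have h := LinearMap.rank_range_add_rank_ker φ
  rw [hk, add_zero] at h
  have hr := (Submodule.rank_le (LinearMap.range φ)).trans_eq (Module.rank_self ℤ)
  rw [h] at hr
  exact Module.finrank_le_of_rank_le (by exact_mod_cast hr)

/-- **Flat complement ⇒ `rank H₂(N; ℤ) ≤ 1`.** If every class in the image of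
`ι_* : H₂(N ∖ B; ℤ) → H₂(N; ℤ)` has finite order, then `rank H₂(N; ℤ) ≤ 1`: by exactness of
`H₂(N ∖ B) → H₂(N) → H₂(N, N ∖ B)` (Hatcher 2002, Thm. 2.16, the tree's
`relativeSingularHomology.exact_map_ofAbsolute`) and `H₂(N, N ∖ B; ℤ) ≅ ℤ` the kernel of the
composite `H₂(N) → ℤ` is the torsion image of `ι_*` (`finrank_le_one_of_ker_torsion`).
[cite: HatcherAT2002, §2.1 Thm. 2.16 and §3.3 Prop. 3.46] -/
theorem finrank_singularHomology_two_le_one_of_flat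
    {N : Type} [TopologicalSpace N] [T2Space N] [CompactSpace N]
    [ChartedSpace (EuclideanSpace ℝ (Fin 4)) N]
    (μ : HomologicalOrientation ℤ N 4)
    {S : Type} [TopologicalSpace S] [CompactSpace S] [ConnectedSpace S]
    [ChartedSpace (EuclideanSpace ℝ (Fin 2)) S]
    (μS : HomologicalOrientation ℤ S 2) {b : S → N} (hb : Topology.IsEmbedding b)
    (hflat : ∀ x, IsOfFinAddOrder (singularHomology.map ℤ ℤ
      (⟨Subtype.val, continuous_subtype_val⟩ : C(↥(Set.range b)ᶜ, N)) 2 x)) :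
    Module.finrank ℤ (singularHomology ℤ ℤ N 2) ≤ 1 := by
  obtain ⟨Θ⟩ := nonempty_linearEquiv_relativeSingularHomology_two_int μ μS hb
  refine finrank_le_one_of_ker_torsion
    (Θ.toLinearMap ∘ₗ (relativeSingularHomology.ofAbsolute ℤ ℤ N (Set.range b)ᶜ 2).hom) ?_
  intro x hx
  have hx' : relativeSingularHomology.ofAbsolute ℤ ℤ N (Set.range b)ᶜ 2 x = 0 := by
    rw [LinearMap.comp_apply, LinearEquiv.coe_coe, LinearEquiv.map_eq_zero_iff] at hx
    exact hx
  obtain ⟨z, rfl⟩ := ((ShortComplex.moduleCat_exact_iff _).1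
    (relativeSingularHomology.exact_map_ofAbsolute ℤ ℤ (Set.range b)ᶜ 2)) x hx'
  exact hflat z

/-- **Meridian injectivity ⇒ `·B : H²(N; ℤ) → ℤ` takes the value `1`.** For the Poincaré dual
`σ` of `b_*[S]` (`σ ⌢ [N] = b_*[S]`): if `H₁(N ∖ B; ℤ) → H₁(N; ℤ)` is injective then some
`a ∈ H²(N; ℤ)` has `⟨a ⌣ σ, [N]⟩ = 1` — in the Thom–Gysin sequence
`H₂(N) →(·B) ℤ →δ H₁(N ∖ B) → H₁(N)` (Bredon 1993, VI.11; the tree's PROVED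
`thomGysin_complement_surface_four_holds`) `im δ = ker ι_* = 0`, so `δ = 0` and `·B` is onto.
[cite: Bredon1993, Ch. VI Thm. 11.3 and Def. 11.8] [cite: HatcherAT2002, §2.1 Thm. 2.16] -/
theorem exists_cupPairing_eq_one_of_injective
    {N : Type} [TopologicalSpace N] [T2Space N] [SecondCountableTopology N] [CompactSpace N]
    [ChartedSpace (EuclideanSpace ℝ (Fin 4)) N] [IsManifold (𝓡 4) ∞ N]
    (μ : HomologicalOrientation ℤ N 4)
    {S : Type} [TopologicalSpace S] [CompactSpace S] [ConnectedSpace S]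
    [ChartedSpace (EuclideanSpace ℝ (Fin 2)) S]
    [IsManifold (𝓡 2) ∞ S] (μS : HomologicalOrientation ℤ S 2) {b : S → N}
    (hb : Manifold.IsSmoothEmbedding (𝓡 2) (𝓡 4) ∞ b) {σ : singularCohomology ℤ ℤ N 2}
    (hσ : poincareDualityMap μ two_add_two_eq_four σ =
      singularHomology.map ℤ ℤ ⟨b, hb.isEmbedding.continuous⟩ 2 μS.fundamentalClass)
    (hinj : Function.Injective (singularHomology.map ℤ ℤ
      (⟨Subtype.val, continuous_subtype_val⟩ : C(↥(Set.range b)ᶜ, N)) 1)) :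
    ∃ a : singularCohomology ℤ ℤ N 2, cupPairing μ two_add_two_eq_four a σ = 1 := by
  obtain ⟨-, δ, hrange, hkerδ⟩ := thomGysin_complement_surface_four_holds N μ S μS b hb σ hσ
  have hkerι : LinearMap.ker (singularHomology.map ℤ ℤ
      (⟨Subtype.val, continuous_subtype_val⟩ : C(↥((Set.range b)ᶜ), N)) 1).hom = ⊥ :=
    LinearMap.ker_eq_bot.mpr hinj
  have hδ : δ = 0 := LinearMap.range_eq_bot.mp (hrange.trans hkerι)
  have htop : LinearMap.range ((cupPairing μ two_add_two_eq_four).flip σ) = ⊤ := by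
    rw [← hkerδ, hδ, LinearMap.ker_zero]
  obtain ⟨a, ha⟩ := LinearMap.range_eq_top.mp htop 1
  exact ⟨a, by rwa [LinearMap.flip_apply] at ha⟩

/-- **Meridian injectivity and flatness pin `rank H₂(N; ℤ) = 1`** (closed `ℤ`-oriented `N`,
closed connected `ℤ`-oriented surface `S` smoothly embedded by `b`): `≤ 1` by
`finrank_singularHomology_two_le_one_of_flat`; `≥ 1` because `⟨a ⌣ σ, [N]⟩ = 1` for some `a`
(`exists_cupPairing_eq_one_of_injective`) makes the Poincaré dual `σ` of `b_*[S]`, hence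
`b_*[S]` itself (Poincaré duality, Hatcher 2002 Thm. 3.30, the tree's `poincare_duality`), a
class of infinite order.
[cite: HatcherAT2002, §3.3 Thm. 3.30] [cite: Bredon1993, Ch. VI Thm. 11.3] -/
theorem finrank_singularHomology_two_eq_one_of_injective_of_flat
    {N : Type} [TopologicalSpace N] [T2Space N] [SecondCountableTopology N] [CompactSpace N]
    [ChartedSpace (EuclideanSpace ℝ (Fin 4)) N] [IsManifold (𝓡 4) ∞ N]
    (μ : HomologicalOrientation ℤ N 4)
    {S : Type} [TopologicalSpace S] [CompactSpace S] [ConnectedSpace S]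
    [ChartedSpace (EuclideanSpace ℝ (Fin 2)) S]
    [IsManifold (𝓡 2) ∞ S] (μS : HomologicalOrientation ℤ S 2) {b : S → N}
    (hb : Manifold.IsSmoothEmbedding (𝓡 2) (𝓡 4) ∞ b)
    (hinj : Function.Injective (singularHomology.map ℤ ℤ
      (⟨Subtype.val, continuous_subtype_val⟩ : C(↥(Set.range b)ᶜ, N)) 1))
    (hflat : ∀ x, IsOfFinAddOrder (singularHomology.map ℤ ℤ
      (⟨Subtype.val, continuous_subtype_val⟩ : C(↥(Set.range b)ᶜ, N)) 2 x)) :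
    Module.finrank ℤ (singularHomology ℤ ℤ N 2) = 1 := by
  haveI : Module.Finite ℤ (singularHomology ℤ ℤ N 2) :=
    finite_singularHomology_of_compact_chartedSpace ℤ ℤ (d := 4) 2
  have hle := finrank_singularHomology_two_le_one_of_flat μ μS hb.isEmbedding hflat
  -- the Poincaré dual `σ = D⁻¹ c` of `c = b_*[S]`
  set D := poincareDualityEquiv μ two_add_two_eq_four (poincare_duality μ two_add_two_eq_four)
    with hD
  set c : singularHomology ℤ ℤ N 2 :=
    singularHomology.map ℤ ℤ ⟨b, hb.isEmbedding.continuous⟩ 2 μS.fundamentalClass with hc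
  have hσ : poincareDualityMap μ two_add_two_eq_four (D.symm c) = c := by
    rw [← poincareDualityEquiv_apply μ two_add_two_eq_four (poincare_duality μ _), ← hD]
    exact D.apply_symm_apply c
  obtain ⟨a, ha⟩ := exists_cupPairing_eq_one_of_injective μ μS hb hσ hinj
  -- `c` has infinite order, so `rank H₂(N) ≠ 0`
  have hne : Module.finrank ℤ (singularHomology ℤ ℤ N 2) ≠ 0 := by
    rw [Ne, Module.finrank_eq_zero_iff, not_forall]
    refine ⟨c, ?_⟩
    rintro ⟨n, hn, hnc⟩
    have hz : n • c = 0 := (int_smul_eq_zsmul _ n c).symm.trans hnc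
    have h2 : cupPairing μ two_add_two_eq_four a (D.symm (n • c)) = n := by
      rw [map_zsmul, map_zsmul, ha, zsmul_eq_mul, mul_one, Int.cast_id]
    rw [hz, map_zero, map_zero] at h2
    exact hn h2.symm
  omega

end PairSequence

/-! ### The `b₂ = 1` half of the stub (registered sub-goal, unconditional) -/

/-- **Registered sub-goal `stub_closingUp_b2` — the `b₂(N) = 1` half of STUB S5, PROVED.**
For a closed connected symplectic `(N, s)` and a smoothly embedded compact connected
`s`-symplectic surface `B = b(S)` with meridian injectivity and flat complement,
`rank H₂(N; ℤ) = 1`.  The symplectic data orient `N` and `S` over `ℤ`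
(`Literature.Geometry.Symplectic.isOrientableOver_int_of_nondegenerate`,
`isOrientableOver_int_surface_of_nondegenerate`); then
`finrank_singularHomology_two_eq_one_of_injective_of_flat`.  (The genus hypothesis and
closedness of `s` are not used.) [cite: Bredon1993, Ch. VI Thm. 11.3 and Def. 11.8]
[cite: HatcherAT2002, §2.1 Thm. 2.16, §3.3 Thm. 3.30 and Prop. 3.46] -/
theorem stub_closingUp_b2 :
    ∀ (N : Type) [TopologicalSpace N] [T2Space N] [SecondCountableTopology N] [CompactSpace N]
      [ConnectedSpace N] [ChartedSpace (EuclideanSpace ℝ (Fin 4)) N] [IsManifold (𝓡 4) ∞ N]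
      (s : MForm (𝓡 4) N ℝ 2)
      (S : Type) [TopologicalSpace S] [T2Space S] [CompactSpace S] [ConnectedSpace S]
      [ChartedSpace (EuclideanSpace ℝ (Fin 2)) S] [IsManifold (𝓡 2) ∞ S] (b : S → N),
      IsSmoothForm s → IsClosedForm s →
      (∀ x (v : TangentSpace (𝓡 4) x), v ≠ 0 → ∃ w, s x ![v, w] ≠ 0) →
      Module.finrank ℤ (singularHomologyZ S 1) = 4 →
      Manifold.IsSmoothEmbedding (𝓡 2) (𝓡 4) ∞ b →
      (∀ y (v : TangentSpace (𝓡 2) y), v ≠ 0 → ∃ w : TangentSpace (𝓡 2) y,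
        s (b y) ![mfderiv (𝓡 2) (𝓡 4) b y v, mfderiv (𝓡 2) (𝓡 4) b y w] ≠ 0) →
      Function.Injective (singularHomology.map ℤ ℤ
        (⟨Subtype.val, continuous_subtype_val⟩ : C(↥(Set.range b)ᶜ, N)) 1) →
      (∀ x, IsOfFinAddOrder (singularHomology.map ℤ ℤ
        (⟨Subtype.val, continuous_subtype_val⟩ : C(↥(Set.range b)ᶜ, N)) 2 x)) →
      Module.finrank ℤ (singularHomologyZ N 2) = 1 := by
  intro N _ _ _ _ _ _ _ s S _ _ _ _ _ _ b hs _ hnd _ hb hsnd hinj hflat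
  obtain ⟨μ⟩ := Literature.Geometry.Symplectic.isOrientableOver_int_of_nondegenerate s hs hnd
  obtain ⟨μS⟩ := Literature.Geometry.Symplectic.isOrientableOver_int_surface_of_nondegenerate
    s hs b hb.contMDiff hsnd
  exact finrank_singularHomology_two_eq_one_of_injective_of_flat μ μS hb hinj hflat

/-! ### The `b₁ = 2` half, modulo `canonicalClass_sq_and_adjunction_of_symplectic_four` -/

/-- **Euler characteristic at `b₂ = 1`**: a closed connected `ℤ`-oriented `4`-manifold with
`rank H₂(N; ℤ) = 1` has `χ(N) = 1 − b₁ + 1 − b₁ + 1 = 3 − 2 b₁` (`χ = Σ (−1)^k rank H_k`,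
Hatcher 2002 §2.2 p. 146; `rank H₀ = rank H₄ = 1`, Thm. 3.26; `rank H₃ = rank H₁` by Poincaré
duality, Thm. 3.30 — the tree's `finrank_singularHomology_three_eq_finrank_one`).
[cite: HatcherAT2002, §2.2 p. 146, Thm. 3.26 and Thm. 3.30] -/
theorem relEuler_eq_of_finrank_two_eq_one {N : Type u} [TopologicalSpace N] [T2Space N]
    [CompactSpace N] [ConnectedSpace N] [ChartedSpace (EuclideanSpace ℝ (Fin 4)) N]
    (μ : HomologicalOrientation ℤ N 4)
    (hb2 : Module.finrank ℤ (singularHomology ℤ ℤ N 2) = 1) :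
    relEuler ℤ ℤ N ∅ = 3 - 2 * (Module.finrank ℤ (singularHomology ℤ ℤ N 1) : ℤ) := by
  have h0 : Module.finrank ℤ (singularHomology ℤ ℤ N 0) = 1 :=
    Literature.Topology.FourManifolds.finrank_singularHomology_zero_eq_one_of_connected_four
  have h3 := finrank_singularHomology_three_eq_finrank_one μ
  have h4 : Module.finrank ℤ (singularHomology ℤ ℤ N 4) = 1 :=
    Literature.Topology.FourManifolds.finrank_singularHomology_four_eq_one μ
  rw [(Literature.Topology.FourManifolds.finRelHomology_of_compactSpace_four
    N).relEuler_empty_eq_sum]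
  simp only [Finset.sum_range_succ, Finset.sum_range_zero, h0, hb2, h3, h4]
  push_cast
  ring

/-- **STUB S5 (closing up), conditional form — the registered signature of `stub_closingUp`,
verbatim, from the named fact `canonicalClass_sq_and_adjunction_of_symplectic_four`**
(McDuff–Salamon 2017, Rem. 4.1.10 eq. (4.1.7) `c₁² = 2χ + 3σ`; Ex. 4.4.5 = (13.3.17), the
adjunction formula `2g − 2 = B·B + K·B` for embedded symplectic surfaces; Gompf–Stipsicz 1999
§1.4).  Given the fact's `μ`, `K`, `μS`: `b₂ = 1`
(`finrank_singularHomology_two_eq_one_of_injective_of_flat`),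
the lattice `H²(N; ℤ)/T = ⟨+1⟩` with coordinate `e` (`exists_linearEquiv_intersectionForm_of_door`),
`σ(N) = 1`, `χ(N) = 3 − 2b₁`; with `σ ≡ m` (the Poincaré dual of `b_*[S]`) and `K ≡ k`,
meridian injectivity gives `m² = 1` (`exists_cupPairing_eq_one_of_injective`), adjunction
`4 − 2 = m² + km` gives `km = 1`, hence `k² = 1 = K² = 2(3 − 2b₁) + 3` and `b₁ = 2`.
[cite: McDuffSalamon2017, Rem. 4.1.10 eq. (4.1.7); Ex. 4.4.5; §13.3 (13.3.17)]
[cite: GompfStipsiczGSM1999, §1.4] -/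
theorem stub_closingUp_of_canonicalClass :
    Literature.Geometry.Symplectic.canonicalClass_sq_and_adjunction_of_symplectic_four →
    ∀ (N : Type) [TopologicalSpace N] [T2Space N] [SecondCountableTopology N] [CompactSpace N]
      [ConnectedSpace N] [ChartedSpace (EuclideanSpace ℝ (Fin 4)) N] [IsManifold (𝓡 4) ∞ N]
      (s : MForm (𝓡 4) N ℝ 2)
      (S : Type) [TopologicalSpace S] [T2Space S] [CompactSpace S] [ConnectedSpace S]
      [ChartedSpace (EuclideanSpace ℝ (Fin 2)) S] [IsManifold (𝓡 2) ∞ S] (b : S → N),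
      IsSmoothForm s → IsClosedForm s →
      (∀ x (v : TangentSpace (𝓡 4) x), v ≠ 0 → ∃ w, s x ![v, w] ≠ 0) →
      Module.finrank ℤ (singularHomologyZ S 1) = 4 →
      Manifold.IsSmoothEmbedding (𝓡 2) (𝓡 4) ∞ b →
      (∀ y (v : TangentSpace (𝓡 2) y), v ≠ 0 → ∃ w : TangentSpace (𝓡 2) y,
        s (b y) ![mfderiv (𝓡 2) (𝓡 4) b y v, mfderiv (𝓡 2) (𝓡 4) b y w] ≠ 0) →
      Function.Injective (singularHomology.map ℤ ℤ
        (⟨Subtype.val, continuous_subtype_val⟩ : C(↥(Set.range b)ᶜ, N)) 1) →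
      (∀ x, IsOfFinAddOrder (singularHomology.map ℤ ℤ
        (⟨Subtype.val, continuous_subtype_val⟩ : C(↥(Set.range b)ᶜ, N)) 2 x)) →
      Module.finrank ℤ (singularHomologyZ N 1) = 2 ∧
        Module.finrank ℤ (singularHomologyZ N 2) = 1 := by
  intro hCSA N _ _ _ _ _ _ _ s S _ _ _ _ _ _ b hs hcl hnd hS1 hb hsnd hinj hflat
  have hS1' : Module.finrank ℤ (singularHomology ℤ ℤ S 1) = 4 := hS1
  obtain ⟨μ, K, hpos, hKK, hadjAll⟩ := hCSA N s hs hcl hnd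
  obtain ⟨μS, -, hadj⟩ := hadjAll S b hb hsnd
  -- `b₂ = 1`
  have hb2 : Module.finrank ℤ (singularHomology ℤ ℤ N 2) = 1 :=
    finrank_singularHomology_two_eq_one_of_injective_of_flat μ μS hb hinj hflat
  refine ⟨?_, hb2⟩
  -- the Poincaré dual `σ = D⁻¹ c` of `c = b_*[S]`
  set D := poincareDualityEquiv μ two_add_two_eq_four (poincare_duality μ two_add_two_eq_four)
    with hD
  set c : singularHomology ℤ ℤ N 2 :=
    singularHomology.map ℤ ℤ ⟨b, hb.isEmbedding.continuous⟩ 2 μS.fundamentalClass with hc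
  have hσ : poincareDualityMap μ two_add_two_eq_four (D.symm c) = c := by
    rw [← poincareDualityEquiv_apply μ two_add_two_eq_four (poincare_duality μ _), ← hD]
    exact D.apply_symm_apply c
  obtain ⟨g, hg⟩ := exists_cupPairing_eq_one_of_injective μ μS hb hσ hinj
  have hadjσ := hadj (D.symm c) hσ
  -- the rank-one lattice `H²(N; ℤ)/T = ⟨+1⟩`, `Q(x, y) = e(x) e(y)`
  obtain ⟨e, he⟩ := exists_linearEquiv_intersectionForm_of_door μ hpos hb2
  have hQ : ∀ x y : singularCohomology ℤ ℤ N 2, cupPairing μ two_add_two_eq_four x y =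
      e (freeCohomology.mk x) * e (freeCohomology.mk y) := fun x y ↦ by
    rw [← intersectionForm_mk_mk]; exact he _ _
  rw [hQ] at hg hKK
  rw [hQ, hQ, hS1'] at hadjσ
  set m : ℤ := e (freeCohomology.mk (D.symm c)) with hm
  set k : ℤ := e (freeCohomology.mk K) with hk
  -- `m² = 1`, `k m = 1`, `k² = 1`
  have hmm : m * m = 1 := by
    rcases Int.eq_one_or_neg_one_of_mul_eq_one' hg with ⟨-, h⟩ | ⟨-, h⟩ <;> rw [h] <;> norm_num
  have hkm : k * m = 1 := by push_cast at hadjσ; linarith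
  have hkk : k * k = 1 := by
    rcases Int.eq_one_or_neg_one_of_mul_eq_one' hkm with ⟨h, -⟩ | ⟨h, -⟩ <;> rw [h] <;> norm_num
  -- `K² = 2χ + 3σ` with `σ = 1`, `χ = 3 − 2 b₁`
  rw [relEuler_eq_of_finrank_two_eq_one μ hb2, signature_eq_one_of_door μ hpos hb2, hkk] at hKK
  have h2 : (Module.finrank ℤ (singularHomology ℤ ℤ N 1) : ℤ) = 2 := by omega
  change Module.finrank ℤ (singularHomology ℤ ℤ N 1) = 2
  exact_mod_cast h2

end Summit.SmoothPoincare4.SmoothPoincare4.Theorems.NoGenusTwoDoor.CanonicalCapFilling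
end
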